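import Literature.NumberTheory.EllipticCurves.KramerTunnell1982.UnramifiedNormIndex
import Literature.NumberTheory.QuadraticForms.HilbertSymbol
import Mathlib.AlgebraicGeometry.EllipticCurve.Reduction
import HarnessLib

/-!
# Kramer–Tunnell 1982, §8 Prop. 8.6 (the local norm index at a place of RESIDUE CHARACTERISTIC 2 for a
# curve with ORDINARY good reduction) and §4 Prop. 4.3 with its proof (twisted Tate curve, `LK/F` of
# degree 4), AS PRINTED

Source: K. Kramer, J. Tunnell, *Elliptic curves and local ε-factors*, Compositio Math. 46 (1982) 307–352
(NUMDAM `CM_1982__46_3_307_0`; PUBLISHED, refereed), materialised on the hub as `paper:url-f1c2eb36a995`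
(locators `pNNNN Lk` = PDF page / line of that copy). TWO named facts (`def … : Prop`, D-0014, nothing asserted),
in the vocabulary of `UnramifiedNormIndex.lean` (`normSubgroup`, `fixedSubgroup`, `maxUnramified`) and of
`Kramer1981/LocalNormCokernel.lean` (Mathlib's `IsNonarchimedeanLocalField`, minimal model `E.minimal 𝒪[F]`, its
reduction, Kodaira symbol, `hilbertSymbol F · d` for the quadratic character `ω` of `K = F(√d)`: `ω(a) = (a, d)_F`).
Requested by the cell `bsd-f1-sign2` (descent lens, MEMO-desc §13.9: rows KT86 / KT43 — the at-`2` input of the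
tower-floor candidate `TowerNormIndexFloorAtTwo` at EVERY ramified quadratic step of the local cyclotomic `ℤ₂`-tower
over an ordinary curve, and the legible source of Kramer 1981 Prop. 2 (b), the `-- TODO(general form)` of
`Kramer1981/LocalNormCokernel.lean`); placement REF2-PLACEMENT-v11 §3 / v12 §0: IN PRINT. Not in Mathlib or the tree
(2026-08-27: `lean search 'Prop. 8.6|prop86|prop43'` in `Literature/` → none; the `KramerTunnell1982/` files hold §6
Lemma 6.1 and its proof inputs only).

## The printed text, verbatim

Setting of §8 [p0030 L8–L14 = p. 335]: "8. The case of residue characteristic 2. Throughout this section `F` is a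
local field with finite residue field `k_F` such that char(`k_F`) `= 2`. Let `U_F` denote the units of `F` and `𝒪_F`
the ring of integers. Let `E` be an elliptic curve defined over `F`, with discriminant `Δ` determined modulo
`(F*)^{12}`. Let `K` be a separable quadratic extension of `F` corresponding to the character `ω` of `F*`. Let
`κ(E, ω) = (−1)^{dim E(F)/NE(K)}`."
[p0030 L26–L28] "LEMMA 8.1: Suppose that `E` has good reduction over `F` and that `K/F` is ramified. Then
`NE(K) = 2E(F) + NE₁(K)` and the following sequence is exact: [display]". [p0030 L41–L42] "Now suppose further
that `E` has ordinary good reduction. Then `|Ẽ(k_F)/2Ẽ(k_F)| = |Ẽ(k_F)₂| = 2` …".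
[p0032 L27–L29 = p. 337] "LEMMA 8.4: If `E` has ordinary good reduction over `F` then `[E₁(F) + 2E(F)]/2E(F)` is
isomorphic to `U_F/U_F² · Δ^ℤ` where `Δ` is the minimal discriminant of `E` and `Δ^ℤ` is the cyclic group generated
by `Δ`." [p0033 L2–L10 = p. 338] "COROLLARY 8.5: Let `E` have ordinary good reduction over `F` and let `K` be a
ramified quadratic extension of `F`. Then [display] … Hence the cokernel of `N` is
`[E₁(F) + 2E(F)]/[NE₁(K) + 2E(F)] = [E₁(F) + NE(K)]/NE(K)` and is isomorphic to `U_F/(NU_K) · Δ^ℤ`, the cokernel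
of `N`."
[p0033 L11–L24 = p. 338] "PROPOSITION 8.6: Suppose that `E` has ordinary good reduction over `F` and that `K/F` is a
quadratic extension corresponding to the character `ω` of `F*`. Then [display]. Furthermore, `κ(E, ω) = ω(Δ)` and
`ε(E, ω) = ω(−Δ)κ(E, ω)`. PROOF: If `K/F` is unramified, then `E(F) = NE(K)` for example by [11, Corollary 4.4].
Since `Δ` is a unit, `ω(Δ) = 1`. … If `K/F` is ramified, then by Lemma 8.1
`|E(F)/NE(K)| = |Ẽ(k_F)/2Ẽ(k_F)| · |[E₁(F) + NE(K)]/NE(K)|`. But `|Ẽ(k_F)/2Ẽ(k_F)| = 2` and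
`|[E₁(F) + NE(K)]/NE(K)| = |U_F/(NU_K) · Δ^ℤ| = 1` or `2`, according to whether `ω(Δ) = −1` or `ω(Δ) = +1`, by
local class field theory." ([11] = Mazur, *Rational points of abelian varieties with values in towers of number
fields*, Invent. Math. 18 (1972).)
Setting of §4 [p0013 L38 ff. = p. 318]: `E/F` with potential multiplicative reduction which becomes a Tate curve
with parameter `q` over the quadratic extension `L` of `F` with character `χ`; `ω` a nontrivial quadratic character of
`F*` with corresponding quadratic extension `K`. [p0014 L30–L35 = p. 319] "PROPOSITION 4.3: With notation as above,
when `LK` has degree 4 over `F` the order of `E(F)/NE(K)` divides 4. Further, `κ(E, ω) = ω(q)`. PROOF: We first note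
that `E(F)/E(F)′` has order dividing 2, and is a nontrivial group if and only if `q` is a norm from `L` (that is, if
and only if `χ(q) = 1`). …" [p0015 L1–L4 = p. 320] "Thus `E(F)′/NE(K)` has order 1 or 2, and is trivial if and only
if `ωχ(q) = −1`. Together with the first sentence of the proof this proves the claim."

## Transcription (tree vocabulary; nothing re-declared)

* `F`: Mathlib nonarchimedean local field of characteristic `0` (`[CharZero F]`; the source allows any local field
  with finite residue field — `-- TODO(general form)`), residue characteristic `2` for Prop. 8.6
  (`ringChar (IsLocalRing.ResidueField 𝒪[F]) = 2`), any for Prop. 4.3; `E : WeierstrassCurve F` elliptic, read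
  through its minimal model `E.minimal 𝒪[F]` (Mathlib), whose discriminant is "the minimal discriminant `Δ`".
* "ordinary good reduction": good reduction of the minimal model and `|Ẽ(k_F)₂| = 2` — EXACTLY the form in which
  ordinarity enters the printed proof [p0030 L41–L42] (`Nat.card` of the `2`-torsion of the reduction's points `= 2`;
  for a supersingular curve in characteristic `2` it is `1`).
* `K/F` quadratic with character `ω`: `K' = F(√d) ≤ F̄`, `[K' : F] = 2`, `σ ≠ 1`, `d` a non-square, `x² = d` in `K'`
  (as in `LocalNormCokernel.lean`); "unramified" = `K' ≤ maxUnramified F`, "ramified" = its negation;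
  `ω(a) = (a, d)_F = hilbertSymbol F a d` (`= +1` iff `a` is a norm from `F(√d)`), so `ω(Δ) = (Δ, d)_F`.
* `|E(F)/NE(K)|` = `(normSubgroup E K' σ).relIndex (fixedSubgroup E K' σ)` (the printed `Ĥ⁰(G, E(K))`, as in §6).
* Prop. 4.3's case used by the cell: `L` = the UNRAMIFIED quadratic extension, i.e. `E` has NON-SPLIT multiplicative
  reduction over `F` (`HasMultiplicativeReduction ∧ ¬ HasSplitMultiplicativeReduction` of the minimal model), `K/F`
  RAMIFIED (then `K ≠ L`, so `LK/F` has degree `4`); `v = v_F(q) = v_F(Δ)` read off the Kodaira type `I_v`;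
  `χ(q) = (−1)^{v}` (`χ` unramified), `ω(q) = (q, d)_F = (Δ, d)_F` (`Δ = q ∏(1 − qⁿ)^{24} · (unit square)`, the
  unramified twist changing `Δ` by a sixth power); hence `|E(F)/E(F)′| = 1 + [v even]` and
  `|E(F)′/NE(K)| = 1 + [(Δ, d)_F = (−1)^v]` (trivial iff `ωχ(q) = −1`).

Faithfulness: `prop86_…` records Prop. 8.6 with the two values of its (OCR-lost) display read from the printed
proof (index `1` unramified; `2·1` or `2·2` ramified according to `ω(Δ) = −1 / +1`); `prop43_…` records Prop. 4.3's
"divides 4" in the EXACT form its printed proof gives, specialised to `L` unramified and `K` ramified. NOT recorded: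
the root-number clauses `κ(E, ω) = ω(Δ)`, `ε(E, ω) = ω(−Δ)κ(E, ω)`, `κ(E, ω) = ω(q)` (they need the local root number,
not typed here), Prop. 4.1 (the case `K = L` or `χ = 1`, already Kramer 1981 Prop. 1 / 2 (a) in
`LocalNormCokernel.lean`), and the supersingular residue-characteristic-2 results 8.7–8.17. Weaker than print only in
`[CharZero F]` and in fixing `L` unramified / `K` ramified in 4.3.
-/

noncomputable section

open ValuativeRel Field
open Literature.NumberTheory.GaloisRepresentations.IsNonarchimedeanLocalField
open Literature.NumberTheory.DiophantineGeometry
open Literature.NumberTheory.QuadraticForms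

namespace Literature.NumberTheory.EllipticCurves.KramerTunnell1982

open scoped Classical

/-- **Kramer–Tunnell 1982, Proposition 8.6** (Compositio Math. 46, §8 "The case of residue characteristic 2",
p. 338; verbatim in the module docstring, with the display read from the printed proof). Setting as printed: `F` a
local field with finite residue field of characteristic `2` (typed: Mathlib nonarchimedean local field, `char F = 0`),
`E/F` elliptic with ORDINARY good reduction ("`|Ẽ(k_F)₂| = 2`", the form used in the proof, p. 335), `K = F(√d)` a
quadratic extension with character `ω`, `ω(Δ) = (Δ, d)_F` for the minimal discriminant `Δ`. Statement: if `K/F` is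
unramified, `E(F) = NE(K)` (index `1`); if `K/F` is ramified, `|E(F)/NE(K)| = |Ẽ(k_F)/2Ẽ(k_F)| ·
|[E₁(F) + NE(K)]/NE(K)| = 2 · (1 or 2)` according to whether `ω(Δ) = −1` or `ω(Δ) = +1` — typed: index `2` resp.
`4`. Named fact (PUBLISHED); nothing asserted; users take `(h : prop86_ordinaryNormIndexResidueCharTwo)`.
[cite: KramerTunnell1982, Prop. 8.6 (p. 338) with Lemma 8.1, Lemma 8.4, Cor. 8.5 (pp. 335–338)] -/
def prop86_ordinaryNormIndexResidueCharTwo : Prop :=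
  ∀ (F : Type) [Field F] [ValuativeRel F] [TopologicalSpace F] [IsNonarchimedeanLocalField F]
    [CharZero F] (_htwo : ringChar (IsLocalRing.ResidueField 𝒪[F]) = 2)
    (E : WeierstrassCurve F) [E.IsElliptic] (_hgood : (E.minimal 𝒪[F]).HasGoodReduction 𝒪[F])
    (_hord : Nat.card (AddSubgroup.torsionBy
      ((E.minimal 𝒪[F]).reduction 𝒪[F]).toAffine.Point (2 : ℤ)) = 2)
    (K' : IntermediateField F (AlgebraicClosure F)) (_h2 : Module.finrank F K' = 2)
    (σ : K' ≃ₐ[F] K') (_hσ : σ ≠ 1) (d : F) (_hd : ¬ IsSquare d) (x : K')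
    (_hx : x ^ 2 = algebraMap F K' d),
    -- `K/F` unramified: `E(F) = NE(K)`
    (K' ≤ maxUnramified F → (normSubgroup E K' σ).relIndex (fixedSubgroup E K' σ) = 1) ∧
    -- `K/F` ramified: index `2 · (1 or 2)` according to `ω(Δ) = −1` or `+1`
    (¬ K' ≤ maxUnramified F →
      (hilbertSymbol F (E.minimal 𝒪[F]).Δ d = -1 →
          (normSubgroup E K' σ).relIndex (fixedSubgroup E K' σ) = 2) ∧
        (hilbertSymbol F (E.minimal 𝒪[F]).Δ d = 1 →
          (normSubgroup E K' σ).relIndex (fixedSubgroup E K' σ) = 4))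

-- TODO(general form): the source allows `char F = 2` (any local field with finite residue field of characteristic 2)
-- and prints the root-number clauses `κ(E, ω) = ω(Δ)`, `ε(E, ω) = ω(−Δ)κ(E, ω)`; neither is recorded here.

/-- **Kramer–Tunnell 1982, Proposition 4.3 with its proof** (Compositio Math. 46, §4 "The case of potential
multiplicative reduction", pp. 319–320; verbatim in the module docstring), ANY residue characteristic: "when `LK`
has degree 4 over `F` the order of `E(F)/NE(K)` divides 4"; proof: "`E(F)/E(F)′` has order dividing 2, and is a
nontrivial group if and only if `q` is a norm from `L` (that is, if and only if `χ(q) = 1`) … `E(F)′/NE(K)` has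
order 1 or 2, and is trivial if and only if `ωχ(q) = −1`." Typed for the case used by the cell `bsd-f1-sign2`
(`L` = the UNRAMIFIED quadratic extension, i.e. `E` has non-split multiplicative reduction over `F`, and `K = F(√d)`
RAMIFIED, so that `LK/F` has degree `4`): with `v = v_F(Δ) = v_F(q)` (Kodaira type `I_v` of the minimal model),
`χ(q) = (−1)^v` and `ω(q) = (q, d)_F = (Δ, d)_F`, the index is
`|E(F)/NE(K)| = (1 + [v even]) · (1 + [(Δ, d)_F = (−1)^v])`. This is the legible printed source of Kramer 1981
Prop. 2 (b) (the `-- TODO(general form)` of `Kramer1981/LocalNormCokernel.lean`). Named fact (PUBLISHED); nothing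
asserted; users take `(h : prop43_twistedTateRamifiedNormIndex)`.
[cite: KramerTunnell1982, Prop. 4.3 and its proof (pp. 319–320)] -/
def prop43_twistedTateRamifiedNormIndex : Prop :=
  ∀ (F : Type) [Field F] [ValuativeRel F] [TopologicalSpace F] [IsNonarchimedeanLocalField F]
    [CharZero F] (E : WeierstrassCurve F) [E.IsElliptic]
    (_hmult : (E.minimal 𝒪[F]).HasMultiplicativeReduction 𝒪[F])
    (_hns : ¬ (E.minimal 𝒪[F]).HasSplitMultiplicativeReduction 𝒪[F])
    (K' : IntermediateField F (AlgebraicClosure F)) (_h2 : Module.finrank F K' = 2)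
    (_hram : ¬ K' ≤ maxUnramified F)
    (σ : K' ≃ₐ[F] K') (_hσ : σ ≠ 1) (d : F) (_hd : ¬ IsSquare d) (x : K')
    (_hx : x ^ 2 = algebraMap F K' d) (v : ℕ) (_hv : E.kodairaSymbol 𝒪[F] = .I v),
    (normSubgroup E K' σ).relIndex (fixedSubgroup E K' σ) =
      (if Even v then 2 else 1) * (if hilbertSymbol F (E.minimal 𝒪[F]).Δ d = (-1) ^ v then 2 else 1)

-- TODO(general form): Prop. 4.3 for `L` ramified (then `K` may be unramified or the other ramified quadratic
-- extension), and its root-number clause `κ(E, ω) = ω(q)`; Prop. 4.1 (`χ = ω` or `χ = 1`) is Kramer 1981 Prop. 1 /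
-- Prop. 2 (a), typed in `Kramer1981/LocalNormCokernel.lean`.

end Literature.NumberTheory.EllipticCurves.KramerTunnell1982

end
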